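import Summits.ValiantsHypothesis.ValiantsHypothesis.Theorems.LacunarySymmetroidMatrixDescartesCensusRootSideM4
import Summits.ValiantsHypothesis.ValiantsHypothesis.Theorems.LacunarySymmetroidMatrixDescartesCensusEnvelopeBudget

/-!
# `MatrixDescartes` census — the ROOT-PAIRING LAWS of a real symmetric `2 × 2` pencil (sign law, Plücker/Ptolemy law, consumer)

HONEST FRAMING.  Object-search cell `pub-symmetroid`; door-A item `DoorA26 = PosRootLawAt 2 6 19`
(stmt-ValiantsHypothesis-19979; OPEN, typed, never asserted).  ALL-SUPPORTS structural facts (every `K`, every exponent vector,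
nothing support-specific) about the values of the polarised determinant form
`ĝ(M, N) = M₀₀N₁₁ + M₁₁N₀₀ − 2·M₀₁N₀₁` (`ĝ(M, M) = 2 det M`) on the matrices `F(r) = ∑ l, r^{d l} S l` of a real symmetric `2 × 2`
pencil at TWO OR FOUR of its determinant roots — the RANK-3 ingredient of the door-A programme written on the ROOT side:

* `trace_mul_trace_mul_pairing_nonneg` — **SIGN LAW**: for singular real symmetric `2 × 2` matrices `M, N`,
  `tr M · tr N · ĝ(M, N) ≥ 0` (indeed `ĝ(M, N) = ε_M ε_N (det[m n])²` for `M = ε_M m mᵀ`, `N = ε_N n nᵀ`; stated square-root free as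
  an SOS identity modulo `det M = det N = 0`); at two roots of a twenty (where `tr F(r) ≠ 0`, `…CensusTwentyRootStructure`) the
  pairing has the sign of the product of the two TYPES;
* `det_fin_four_of_diag_eq_zero`, `ptolemy_pairing_eq_zero_of_det_eq_zero` — **PLÜCKER / PTOLEMY LAW**: for four singular real symmetric
  `2 × 2` matrices the six pairings `z_ab = ĝ(S a, S b)` satisfy `p² + q² + r² − 2pq − 2qr − 2rp = 0` with `p = z₀₁z₂₃, q = z₀₂z₁₃,
  r = z₀₃z₁₂` (the `4 × 4` Gram determinant `Census.gram_det_four_eq_zero` with ZERO DIAGONAL), and `pq, qr, rp ≥ 0` when the traces are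
  non-zero (`pairing_prod_nonneg_of_det_eq_zero`); with `p, q, r ≥ 0` this says `√p, √q, √r` form a DEGENERATE triangle — the Plücker
  relation `[ab][cd] − [ac][bd] + [ad][bc] = 0` of the four kernel vectors, i.e. Ptolemy's EQUALITY for the four null directions on the
  conic of `ℝ^{1,2}` (a complex-Hermitian `2 × 2` pencil, `ℝ^{1,3}`, only obeys Ptolemy's INEQUALITY: its null directions live on a sphere);
* `pairing_pencil_eval`, `pairing_pencil_eval_eq_sum_coeff` — the pairing of the evaluated pencil at `x, y` is the bilinear fewnomial
  `∑ l l', x^{d l} y^{d l'} ĝ(S l, S l')`, on a 2-Sidon support `= ∑ i j, x^{d i} y^{d j} · Ĝ_ij` with `Ĝ_ij = (2|1)·coeff (det F) (d i + d j)`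
  (`gramHat_entry_of_sidon`) — so at the roots of a hypothetical twenty every pairing is `t ·` an explicit signed sum of generalised
  Vandermonde minors of the roots (`exists_roots_coeff_det_eq_mul_signedMinor`);
* `rootPairing_laws_of_twenty` — what a hypothetical twenty supplies on the root side, assembled (any support): sorted positive roots
  `ρ`, non-zero traces `τ a = tr F(ρ a)` flipping at most three times (`card_traceFlips_le_three_of_twenty`), the sign law
  `τ a · τ b · ĝ(F(ρ a), F(ρ b)) ≥ 0`, zero diagonal, and the Ptolemy law at every quadruple;
* `card_posRoots_le_19_of_rootPairing_ptolemy_ne_zero` — **the consumer** («root-pairing Ptolemy defect ≠ 0 somewhere ⇒ no twenty on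
  `d`»): on a 2-Sidon six-support, if for every sorted positive `ρ : Fin 20 → ℝ` some quadruple of indices has a NON-ZERO Ptolemy form of
  the root-side pairings `W_ab(ρ) = ∑ i j, ρ_a^{d i} ρ_b^{d j} (2|1)(−1)^u c_u(ρ)` (`u = uOf i j`), then every real symmetric `2 × 2` pencil on
  `d` has at most `19` distinct positive determinant roots (pencil side: the law above; root side: coefficients `= t · c(ρ)`, the form is
  homogeneous of degree `4`).  Equivalent to «rank `Ĝ(c(ρ)) ≥ 4`» (`…CensusRootSideM4`) but through PRINCIPAL minors of the zero-diagonal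
  root Gram matrix, invariant under every row/column balancing.

Nothing here is specific to one support, asserts any `M4-POS`/Ptolemy statement, or bears on `DoorA26` / `DoorA34` (OPEN) as format-level
statements, on the crux `MatrixDescartes` (stmt-ValiantsHypothesis-18050), or on `VP ≠ VNP`.  [folklore] Linear algebra of `Sym₂(ℝ) ≅ ℝ^{1,2}`.
-/

-- `Summit.ValiantsHypothesis.ValiantsHypothesis.…` repeats a component by the D-0017 layout
-- (single-conjunct summit), which the `dupNamespace` linter flags; the name is mandated.
set_option linter.dupNamespace false

namespace Summit.ValiantsHypothesis.ValiantsHypothesis.Theorems.LacunarySymmetroidMatrixDescartes.Census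

open Polynomial Finset
open scoped BigOperators Polynomial Matrix
open Summit.ValiantsHypothesis.ValiantsHypothesis.Theorems.SymmetroidDescartes (eval_det_pencil)

/-! ### Pointwise laws for singular real symmetric `2 × 2` matrices -/

/-- `ĝ(M, M) = 2 det M` for a symmetric `2 × 2` matrix. [folklore] -/
theorem pairing_self_eq_two_mul_det (M : Matrix (Fin 2) (Fin 2) ℝ) (hM : M.IsSymm) :
    M 0 0 * M 1 1 + M 1 1 * M 0 0 - 2 * (M 0 1 * M 0 1) = 2 * M.det := by
  have h10 : M 1 0 = M 0 1 := by simpa using congrFun (congrFun hM 0) 1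
  rw [Matrix.det_fin_two, h10]
  ring

/-- **SIGN LAW.**  For two SINGULAR real symmetric `2 × 2` matrices `M, N`: `tr M · tr N · ĝ(M, N) ≥ 0`, where
`ĝ(M, N) = M₀₀N₁₁ + M₁₁N₀₀ − 2 M₀₁N₀₁` is the polarised determinant form.  (Writing `M = ε_M m mᵀ`, `N = ε_N n nᵀ`:
`ĝ(M,N) = ε_M ε_N det[m n]²` and `tr M = ε_M |m|²`; the proof is the square-root-free SOS identity
`tr M · tr N · ĝ = (M₀₀N₀₁ − N₀₀M₀₁)² + (M₀₀N₁₁ − M₀₁N₀₁)² + (M₁₁N₀₀ − M₀₁N₀₁)² + (M₀₁N₁₁ − M₁₁N₀₁)²` modulo `det M = det N = 0`.)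
At two det-roots of a symmetric pencil with non-zero traces: the pairing has the sign of the product of the two TYPES. [folklore] -/
theorem trace_mul_trace_mul_pairing_nonneg (M N : Matrix (Fin 2) (Fin 2) ℝ) (hM : M.IsSymm) (hN : N.IsSymm)
    (hdM : M.det = 0) (hdN : N.det = 0) :
    0 ≤ (M 0 0 + M 1 1) * (N 0 0 + N 1 1) * (M 0 0 * N 1 1 + M 1 1 * N 0 0 - 2 * (M 0 1 * N 0 1)) := by
  have hM10 : M 1 0 = M 0 1 := by simpa using congrFun (congrFun hM 0) 1
  have hN10 : N 1 0 = N 0 1 := by simpa using congrFun (congrFun hN 0) 1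
  rw [Matrix.det_fin_two, hM10] at hdM
  rw [Matrix.det_fin_two, hN10] at hdN
  have key : (M 0 0 + M 1 1) * (N 0 0 + N 1 1) * (M 0 0 * N 1 1 + M 1 1 * N 0 0 - 2 * (M 0 1 * N 0 1)) =
      (M 0 0 * N 0 1 - N 0 0 * M 0 1) ^ 2 + (M 0 0 * N 1 1 - M 0 1 * N 0 1) ^ 2 +
        (M 1 1 * N 0 0 - M 0 1 * N 0 1) ^ 2 + (M 0 1 * N 1 1 - M 1 1 * N 0 1) ^ 2 +
        (N 0 0 + N 1 1) ^ 2 * (M 0 0 * M 1 1 - M 0 1 * M 0 1) +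
        (M 0 0 ^ 2 + 2 * M 0 1 ^ 2 + M 1 1 ^ 2) * (N 0 0 * N 1 1 - N 0 1 * N 0 1) := by
    ring
  rw [key, hdM, hdN]
  positivity

/-- **`4 × 4` determinant with zero diagonal = the Ptolemy form.**  For a symmetric array `z` with `z a a = 0`:
`det (z a b) = p² + q² + r² − 2pq − 2qr − 2rp`, `p = z₀₁z₂₃`, `q = z₀₂z₁₃`, `r = z₀₃z₁₂` (for `p, q, r ≥ 0` this vanishes iff
`√p, √q, √r` form a degenerate triangle — Ptolemy's equality). [folklore] -/
theorem det_fin_four_of_diag_eq_zero (z : Fin 4 → Fin 4 → ℝ) (hsymm : ∀ a b, z a b = z b a) (hdiag : ∀ a, z a a = 0) :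
    (Matrix.of fun a b => z a b).det =
      (z 0 1 * z 2 3) ^ 2 + (z 0 2 * z 1 3) ^ 2 + (z 0 3 * z 1 2) ^ 2
        - 2 * (z 0 1 * z 2 3 * (z 0 2 * z 1 3)) - 2 * (z 0 2 * z 1 3 * (z 0 3 * z 1 2))
        - 2 * (z 0 3 * z 1 2 * (z 0 1 * z 2 3)) := by
  rw [det_fin_four]
  simp only [Matrix.of_apply, hdiag, hsymm 1 0, hsymm 2 0, hsymm 3 0, hsymm 2 1, hsymm 3 1, hsymm 3 2]
  ring

/-- **PLÜCKER / PTOLEMY LAW.**  For four SINGULAR real symmetric `2 × 2` matrices, the six pairings `z a b = ĝ(S a, S b)`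
(given as any array `z` satisfying `hz`) satisfy `p² + q² + r² − 2pq − 2qr − 2rp = 0`, `p = z₀₁z₂₃, q = z₀₂z₁₃, r = z₀₃z₁₂`:
four vectors of the `3`-space `Sym₂(ℝ)` have a singular Gram matrix (`gram_det_four_eq_zero`), and here its diagonal
`z a a = 2 det (S a)` vanishes (`det_fin_four_of_diag_eq_zero`).  With `S a = ε_a v_a v_aᵀ` this is the square-root-free form
of the Plücker relation `det[v₀v₁]det[v₂v₃] − det[v₀v₂]det[v₁v₃] + det[v₀v₃]det[v₁v₂] = 0`, i.e. Ptolemy's EQUALITY for the four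
kernel directions on the conic of null directions of `ℝ^{1,2}`. [folklore] -/
theorem ptolemy_pairing_eq_zero_of_det_eq_zero (S : Fin 4 → Matrix (Fin 2) (Fin 2) ℝ) (hS : ∀ a, (S a).IsSymm)
    (hdet : ∀ a, (S a).det = 0) (z : Fin 4 → Fin 4 → ℝ)
    (hz : ∀ a b, z a b = S a 0 0 * S b 1 1 + S a 1 1 * S b 0 0 - 2 * (S a 0 1 * S b 0 1)) :
    (z 0 1 * z 2 3) ^ 2 + (z 0 2 * z 1 3) ^ 2 + (z 0 3 * z 1 2) ^ 2
        - 2 * (z 0 1 * z 2 3 * (z 0 2 * z 1 3)) - 2 * (z 0 2 * z 1 3 * (z 0 3 * z 1 2))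
        - 2 * (z 0 3 * z 1 2 * (z 0 1 * z 2 3)) = 0 := by
  have h := gram_det_four_eq_zero S
  have hof : (Matrix.of fun i j : Fin 4 => S i 0 0 * S j 1 1 + S i 1 1 * S j 0 0 - 2 * (S i 0 1 * S j 0 1)) =
      Matrix.of fun a b => z a b := by
    ext a b
    rw [Matrix.of_apply, Matrix.of_apply, hz]
  have hsymm : ∀ a b, z a b = z b a := fun a b => by rw [hz, hz]; ring
  have hdiag : ∀ a, z a a = 0 := fun a => by rw [hz, pairing_self_eq_two_mul_det _ (hS a), hdet a, mul_zero]
  rw [hof, det_fin_four_of_diag_eq_zero z hsymm hdiag] at h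
  exact h

/-- **Same-sign law for the three Ptolemy products.**  For four singular real symmetric `2 × 2` matrices with NON-ZERO traces,
the products `p·q`, `q·r`, `r·p` of `p = z₀₁z₂₃, q = z₀₂z₁₃, r = z₀₃z₁₂` (`z a b = ĝ(S a, S b)`) are all `≥ 0`: each `z a b` has the
sign `ε_a ε_b` of the product of the types (`trace_mul_trace_mul_pairing_nonneg`), so `p, q, r` share the sign `ε₀ε₁ε₂ε₃` — with the
Ptolemy law, `√|p|, √|q|, √|r|` form a degenerate triangle. [folklore] -/
theorem pairing_prod_nonneg_of_det_eq_zero (S : Fin 4 → Matrix (Fin 2) (Fin 2) ℝ) (hS : ∀ a, (S a).IsSymm)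
    (hdet : ∀ a, (S a).det = 0) (htr : ∀ a, S a 0 0 + S a 1 1 ≠ 0) (z : Fin 4 → Fin 4 → ℝ)
    (hz : ∀ a b, z a b = S a 0 0 * S b 1 1 + S a 1 1 * S b 0 0 - 2 * (S a 0 1 * S b 0 1)) :
    0 ≤ z 0 1 * z 2 3 * (z 0 2 * z 1 3) ∧ 0 ≤ z 0 2 * z 1 3 * (z 0 3 * z 1 2) ∧
      0 ≤ z 0 3 * z 1 2 * (z 0 1 * z 2 3) := by
  -- opaque traces
  obtain ⟨τ, hτ⟩ : ∃ τ : Fin 4 → ℝ, ∀ a, τ a = S a 0 0 + S a 1 1 := ⟨_, fun _ => rfl⟩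
  have hzz : ∀ a b, 0 ≤ τ a * τ b * z a b := fun a b => by
    rw [hτ, hτ, hz]
    exact trace_mul_trace_mul_pairing_nonneg (S a) (S b) (hS a) (hS b) (hdet a) (hdet b)
  have hτ0 : ∀ a, τ a ≠ 0 := fun a => by rw [hτ]; exact htr a
  have hT : 0 < (τ 0 * τ 1 * τ 2 * τ 3) ^ 2 := by
    have := hτ0 0; have := hτ0 1; have := hτ0 2; have := hτ0 3
    positivity
  have key : ∀ a b c e : Fin 4, ({a, b, c, e} : Finset (Fin 4)) = Finset.univ →
      0 ≤ z a b * z c e * (z a c * z b e) := by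
    intro a b c e _
    have h4 := mul_nonneg (mul_nonneg (hzz a b) (hzz c e)) (mul_nonneg (hzz a c) (hzz b e))
    have heq : τ a * τ b * z a b * (τ c * τ e * z c e) * (τ a * τ c * z a c * (τ b * τ e * z b e)) =
        (τ a * τ b * τ c * τ e) ^ 2 * (z a b * z c e * (z a c * z b e)) := by ring
    rw [heq] at h4
    have hT' : 0 < (τ a * τ b * τ c * τ e) ^ 2 := by
      have := hτ0 a; have := hτ0 b; have := hτ0 c; have := hτ0 e
      positivity
    by_contra hx
    exact absurd h4 (not_le.mpr (mul_neg_of_pos_of_neg hT' (not_le.mp hx)))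
  have hsymm : ∀ a b, z a b = z b a := fun a b => by rw [hz, hz]; ring
  refine ⟨key 0 1 2 3 (by decide), ?_, ?_⟩
  · have h := key 0 2 3 1 (by decide)
    rwa [hsymm 3 1, hsymm 2 1] at h
  · have h := key 0 3 1 2 (by decide)
    rwa [hsymm 3 2] at h

/-! ### The pairing of the evaluated pencil: a bilinear fewnomial in the two points -/

/-- **Bilinear expansion.**  For ANY `2 × 2` pencil `F(x) = ∑ l, x^{d l} • S l`:
`ĝ(F(x), F(y)) = ∑ l, ∑ l', x^{d l} y^{d l'} ĝ(S l, S l')`. [folklore] -/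
theorem pairing_pencil_eval {K : ℕ} (d : Fin K → ℕ) (S : Fin K → Matrix (Fin 2) (Fin 2) ℝ) (x y : ℝ) :
    (∑ l, x ^ d l • S l) 0 0 * (∑ l, y ^ d l • S l) 1 1 + (∑ l, x ^ d l • S l) 1 1 * (∑ l, y ^ d l • S l) 0 0
        - 2 * ((∑ l, x ^ d l • S l) 0 1 * (∑ l, y ^ d l • S l) 0 1)
      = ∑ l, ∑ l', x ^ d l * y ^ d l' * (S l 0 0 * S l' 1 1 + S l 1 1 * S l' 0 0 - 2 * (S l 0 1 * S l' 0 1)) := by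
  simp only [pencil_apply]
  rw [Finset.sum_mul_sum, Finset.sum_mul_sum, Finset.sum_mul_sum, Finset.mul_sum, ← Finset.sum_add_distrib,
    ← Finset.sum_sub_distrib]
  refine Finset.sum_congr rfl fun l _ => ?_
  rw [Finset.mul_sum, ← Finset.sum_add_distrib, ← Finset.sum_sub_distrib]
  refine Finset.sum_congr rfl fun l' _ => ?_
  ring

/-- **On a 2-Sidon support the pairing of the evaluated pencil is read off the determinant coefficients**:
`ĝ(F(x), F(y)) = ∑ i, ∑ j, x^{d i} y^{d j} · Ĝ_ij`, `Ĝ_ij = (2 if i = j else 1) · coeff (det F) (d i + d j)` (`gramHat_entry_of_sidon`).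
In particular `ĝ(F(x), F(x)) = 2 det F(x)`, and at the roots of a hypothetical twenty every pairing is `t ·` an explicit signed sum of
generalised Vandermonde minors of the roots. [folklore] -/
theorem pairing_pencil_eval_eq_sum_coeff {K : ℕ} (d : Fin K → ℕ)
    (hSidon : ∀ p q : Fin K × Fin K, d p.1 + d p.2 = d q.1 + d q.2 → p = q ∨ p = q.swap)
    (S : Fin K → Matrix (Fin 2) (Fin 2) ℝ) (hS : ∀ l, (S l).IsSymm) (x y : ℝ) :
    (∑ l, x ^ d l • S l) 0 0 * (∑ l, y ^ d l • S l) 1 1 + (∑ l, x ^ d l • S l) 1 1 * (∑ l, y ^ d l • S l) 0 0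
        - 2 * ((∑ l, x ^ d l • S l) 0 1 * (∑ l, y ^ d l • S l) 0 1)
      = ∑ i, ∑ j, x ^ d i * y ^ d j *
          ((if i = j then (2 : ℝ) else 1) * (∑ l, ((X : ℝ[X]) ^ d l) • (S l).map C).det.coeff (d i + d j)) := by
  rw [pairing_pencil_eval]
  refine Finset.sum_congr rfl fun i _ => Finset.sum_congr rfl fun j _ => ?_
  rw [gramHat_entry_of_sidon d hSidon S hS i j]

/-! ### What a hypothetical twenty supplies on the root side (any six-term support) -/

/-- The evaluated pencil of symmetric letters is symmetric. [folklore] -/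
theorem pencil_eval_isSymm {K : ℕ} (d : Fin K → ℕ) (S : Fin K → Matrix (Fin 2) (Fin 2) ℝ) (hS : ∀ l, (S l).IsSymm)
    (x : ℝ) : (∑ l, x ^ d l • S l).IsSymm := by
  unfold Matrix.IsSymm
  rw [Matrix.transpose_sum]
  exact Finset.sum_congr rfl fun l _ => by rw [Matrix.transpose_smul, (hS l).eq]

/-- **ROOT-PAIRING LAWS OF A TWENTY, assembled** (symmetric letters, ANY six-term support).  If a real symmetric `2 × 2` six-term
pencil `F` has at least `20` distinct positive det-roots, there are sorted positive roots `ρ 0 < ⋯ < ρ 19` such that, writing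
`τ a = tr F(ρ a)` and `z a b = ĝ(F(ρ a), F(ρ b))`:
(i) every `τ a ≠ 0` and `τ` flips sign at most three times along `ρ` (`card_traceFlips_le_three_of_twenty`);
(ii) SIGN LAW `τ a · τ b · z a b ≥ 0` for all `a, b`;  (iii) ZERO DIAGONAL `z a a = 0`;
(iv) PTOLEMY LAW at every quadruple `q : Fin 4 → Fin 20` (for any array `z` of the six pairings): `p² + q² + r² − 2pq − 2qr − 2rp = 0` for
`p = z(q0)(q1)·z(q2)(q3)`, `q = z(q0)(q2)·z(q1)(q3)`, `r = z(q0)(q3)·z(q1)(q2)`.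
A complex-Hermitian twenty (which exists on the open-core cell `(0,2,3,7,15,26)+`, theory-3 g18) satisfies (i)–(iii) but only the
INEQUALITY form of (iv). [folklore] -/
theorem rootPairing_laws_of_twenty (d : Fin 6 → ℕ) (S : Fin 6 → Matrix (Fin 2) (Fin 2) ℝ) (hS : ∀ l, (S l).IsSymm)
    (h20 : 20 ≤ ((Matrix.det (∑ l, ((X : ℝ[X]) ^ d l) • (S l).map C)).roots.toFinset.filter (fun t => 0 < t)).card) :
    ∃ ρ : Fin 20 → ℝ, (∀ a, 0 < ρ a) ∧ StrictMono ρ ∧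
      (∀ a, (Matrix.det (∑ l, ((X : ℝ[X]) ^ d l) • (S l).map C)).IsRoot (ρ a)) ∧
      (∀ a, (∑ l, ρ a ^ d l • S l) 0 0 + (∑ l, ρ a ^ d l • S l) 1 1 ≠ 0) ∧
      (Finset.univ.filter (fun k : Fin 19 =>
        ((∑ l, ρ k.castSucc ^ d l • S l) 0 0 + (∑ l, ρ k.castSucc ^ d l • S l) 1 1) *
          ((∑ l, ρ k.succ ^ d l • S l) 0 0 + (∑ l, ρ k.succ ^ d l • S l) 1 1) < 0)).card ≤ 3 ∧
      (∀ a b, 0 ≤ ((∑ l, ρ a ^ d l • S l) 0 0 + (∑ l, ρ a ^ d l • S l) 1 1) *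
          ((∑ l, ρ b ^ d l • S l) 0 0 + (∑ l, ρ b ^ d l • S l) 1 1) *
          ((∑ l, ρ a ^ d l • S l) 0 0 * (∑ l, ρ b ^ d l • S l) 1 1 + (∑ l, ρ a ^ d l • S l) 1 1 * (∑ l, ρ b ^ d l • S l) 0 0
            - 2 * ((∑ l, ρ a ^ d l • S l) 0 1 * (∑ l, ρ b ^ d l • S l) 0 1))) ∧
      (∀ a, (∑ l, ρ a ^ d l • S l) 0 0 * (∑ l, ρ a ^ d l • S l) 1 1 + (∑ l, ρ a ^ d l • S l) 1 1 * (∑ l, ρ a ^ d l • S l) 0 0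
            - 2 * ((∑ l, ρ a ^ d l • S l) 0 1 * (∑ l, ρ a ^ d l • S l) 0 1) = 0) ∧
      (∀ q : Fin 4 → Fin 20, ∀ z : Fin 4 → Fin 4 → ℝ,
        (∀ a b, z a b =
          (∑ l, ρ (q a) ^ d l • S l) 0 0 * (∑ l, ρ (q b) ^ d l • S l) 1 1 +
            (∑ l, ρ (q a) ^ d l • S l) 1 1 * (∑ l, ρ (q b) ^ d l • S l) 0 0 -
            2 * ((∑ l, ρ (q a) ^ d l • S l) 0 1 * (∑ l, ρ (q b) ^ d l • S l) 0 1)) →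
        (z 0 1 * z 2 3) ^ 2 + (z 0 2 * z 1 3) ^ 2 + (z 0 3 * z 1 2) ^ 2
          - 2 * (z 0 1 * z 2 3 * (z 0 2 * z 1 3)) - 2 * (z 0 2 * z 1 3 * (z 0 3 * z 1 2))
          - 2 * (z 0 3 * z 1 2 * (z 0 1 * z 2 3)) = 0) := by
  classical
  set p := Matrix.det (∑ l, ((X : ℝ[X]) ^ d l) • (S l).map C) with hp
  have hp0 : p ≠ 0 := by
    intro h0; rw [h0, Polynomial.roots_zero] at h20; simp at h20
  -- twenty sorted positive roots
  set Z := p.roots.toFinset.filter (fun t => 0 < t) with hZ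
  obtain ⟨T, hTZ, hTcard⟩ := Finset.exists_subset_card_eq h20
  let ρ : Fin 20 → ℝ := fun a => (T.orderEmbOfFin hTcard) a
  have hρmem : ∀ a, ρ a ∈ Z := fun a => hTZ (Finset.orderEmbOfFin_mem T hTcard a)
  have hρ0 : ∀ a, 0 < ρ a := fun a => (Finset.mem_filter.mp (hρmem a)).2
  have hρroot : ∀ a, p.IsRoot (ρ a) := fun a =>
    (Polynomial.mem_roots hp0).mp (Multiset.mem_toFinset.mp (Finset.mem_filter.mp (hρmem a)).1)
  have hρmono : StrictMono ρ := (T.orderEmbOfFin hTcard).strictMono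
  have hdet : ∀ a, (∑ l, ρ a ^ d l • S l).det = 0 := fun a => by
    rw [← eval_det_pencil S d (ρ a)]; exact hρroot a
  have hsym : ∀ a, (∑ l, ρ a ^ d l • S l).IsSymm := fun a => pencil_eval_isSymm d S hS (ρ a)
  have htr : ∀ a, (∑ l, ρ a ^ d l • S l) 0 0 + (∑ l, ρ a ^ d l • S l) 1 1 ≠ 0 := fun a =>
    trace_pencil_eval_ne_zero_of_twenty d S hS h20 (hρ0 a) (hρroot a)
  refine ⟨ρ, hρ0, hρmono, hρroot, htr, ?_, ?_, ?_, ?_⟩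
  · exact card_traceFlips_le_three_of_twenty d S hS ρ hρmono hρ0
      (fun a => (Polynomial.mem_roots hp0).mpr (hρroot a))
  · intro a b
    exact trace_mul_trace_mul_pairing_nonneg _ _ (hsym a) (hsym b) (hdet a) (hdet b)
  · intro a
    rw [pairing_self_eq_two_mul_det _ (hsym a), hdet a, mul_zero]
  · intro q z hz
    exact ptolemy_pairing_eq_zero_of_det_eq_zero (fun a => ∑ l, ρ (q a) ^ d l • S l)
      (fun a => hsym (q a)) (fun a => hdet (q a)) z hz

/-! ### The consumer: «root-pairing Ptolemy defect ≠ 0 somewhere ⇒ no twenty on d» (2-Sidon six-supports) -/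

/-- **The root-pairing consumer.**  Let `d : Fin 6 → ℕ` be 2-Sidon with its pair sums enumerated increasingly by `E` through an
index table `uOf` (`E (uOf i j) = d i + d j`), and let `W ρ a b = ∑ i j, ρ_a^{d i} ρ_b^{d j} · (2|1) · (−1)^u c_u(ρ)` (`u = uOf i j`,
`c_u(ρ)` the maximal generalised-Vandermonde minors of `ρ`) be the ROOT-SIDE PAIRING (given as any function `W` satisfying `hW`).
If for every sorted positive `ρ : Fin 20 → ℝ` some quadruple `q : Fin 4 → Fin 20` has a NON-ZERO Ptolemy form
`p² + q² + r² − 2pq − 2qr − 2rp`, `p = W(q0,q1)W(q2,q3)`, `q = W(q0,q2)W(q1,q3)`, `r = W(q0,q3)W(q1,q2)`, then every real symmetric `2 × 2`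
pencil on `d` has at most `19` distinct positive determinant roots.  (Pencil side: at four roots of a twenty the pairings
`ĝ(F(ρ a), F(ρ b)) = t · W ρ a b` obey the Ptolemy law `ptolemy_pairing_eq_zero_of_det_eq_zero`, and the form is homogeneous of
degree `4` in `t ≠ 0`.) [folklore] -/
theorem card_posRoots_le_19_of_rootPairing_ptolemy_ne_zero (d : Fin 6 → ℕ)
    (hSidon : ∀ p q : Fin 6 × Fin 6, d p.1 + d p.2 = d q.1 + d q.2 → p = q ∨ p = q.swap)
    (E : Fin 21 → ℕ) (hE : StrictMono E) (uOf : Fin 6 → Fin 6 → Fin 21) (huOf : ∀ i j, E (uOf i j) = d i + d j)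
    (W : (Fin 20 → ℝ) → Fin 20 → Fin 20 → ℝ)
    (hW : ∀ ρ a b, W ρ a b = ∑ i, ∑ j, ρ a ^ d i * ρ b ^ d j *
      ((if i = j then (2 : ℝ) else 1) *
        ((-1 : ℝ) ^ (uOf i j : ℕ) * (Matrix.of fun k v => ρ k ^ E ((uOf i j).succAbove v)).det)))
    (hpt : ∀ ρ : Fin 20 → ℝ, (∀ a, 0 < ρ a) → StrictMono ρ → ∃ q : Fin 4 → Fin 20,
      (W ρ (q 0) (q 1) * W ρ (q 2) (q 3)) ^ 2 + (W ρ (q 0) (q 2) * W ρ (q 1) (q 3)) ^ 2 +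
          (W ρ (q 0) (q 3) * W ρ (q 1) (q 2)) ^ 2
        - 2 * (W ρ (q 0) (q 1) * W ρ (q 2) (q 3) * (W ρ (q 0) (q 2) * W ρ (q 1) (q 3)))
        - 2 * (W ρ (q 0) (q 2) * W ρ (q 1) (q 3) * (W ρ (q 0) (q 3) * W ρ (q 1) (q 2)))
        - 2 * (W ρ (q 0) (q 3) * W ρ (q 1) (q 2) * (W ρ (q 0) (q 1) * W ρ (q 2) (q 3))) ≠ 0)
    (S : Fin 6 → Matrix (Fin 2) (Fin 2) ℝ) (hS : ∀ l, (S l).IsSymm) :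
    ((∑ l, ((X : ℝ[X]) ^ d l) • (S l).map C).det.roots.toFinset.filter (fun t => 0 < t)).card ≤ 19 := by
  by_contra hlt
  have h20 : 20 ≤ ((∑ l, ((X : ℝ[X]) ^ d l) • (S l).map C).det.roots.toFinset.filter
      (fun t => 0 < t)).card := by omega
  have hWE : ∀ p : Fin 6 × Fin 6, d p.1 + d p.2 ∈ Finset.univ.image E :=
    fun p => Finset.mem_image.mpr ⟨uOf p.1 p.2, Finset.mem_univ _, huOf p.1 p.2⟩
  obtain ⟨ρ, hρ0, hρ, hroot, t, ht, hcoeff⟩ :=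
    exists_roots_coeff_det_eq_mul_signedMinor d S E hE hWE (by norm_num) h20
  obtain ⟨q, hq⟩ := hpt ρ hρ0 hρ
  -- the four singular symmetric matrices `F(ρ (q a))`
  have hdet : ∀ a, (∑ l, ρ a ^ d l • S l).det = 0 := fun a => by
    rw [← eval_det_pencil S d (ρ a)]; exact hroot a
  have hsym : ∀ a, (∑ l, ρ a ^ d l • S l).IsSymm := fun a => pencil_eval_isSymm d S hS (ρ a)
  -- each pairing is `t · W ρ a b`
  have hz : ∀ a b : Fin 20,
      (∑ l, ρ a ^ d l • S l) 0 0 * (∑ l, ρ b ^ d l • S l) 1 1 + (∑ l, ρ a ^ d l • S l) 1 1 * (∑ l, ρ b ^ d l • S l) 0 0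
        - 2 * ((∑ l, ρ a ^ d l • S l) 0 1 * (∑ l, ρ b ^ d l • S l) 0 1) = t * W ρ a b := by
    intro a b
    rw [pairing_pencil_eval_eq_sum_coeff d hSidon S hS, hW, Finset.mul_sum]
    refine Finset.sum_congr rfl fun i _ => ?_
    rw [Finset.mul_sum]
    refine Finset.sum_congr rfl fun j _ => ?_
    rw [← huOf i j, hcoeff (uOf i j)]
    ring
  have hlaw := ptolemy_pairing_eq_zero_of_det_eq_zero (fun a => ∑ l, ρ (q a) ^ d l • S l)
    (fun a => hsym (q a)) (fun a => hdet (q a)) (fun a b => t * W ρ (q a) (q b)) (fun a b => (hz (q a) (q b)).symm)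
  have h4 : t ^ 4 * ((W ρ (q 0) (q 1) * W ρ (q 2) (q 3)) ^ 2 + (W ρ (q 0) (q 2) * W ρ (q 1) (q 3)) ^ 2 +
          (W ρ (q 0) (q 3) * W ρ (q 1) (q 2)) ^ 2
        - 2 * (W ρ (q 0) (q 1) * W ρ (q 2) (q 3) * (W ρ (q 0) (q 2) * W ρ (q 1) (q 3)))
        - 2 * (W ρ (q 0) (q 2) * W ρ (q 1) (q 3) * (W ρ (q 0) (q 3) * W ρ (q 1) (q 2)))
        - 2 * (W ρ (q 0) (q 3) * W ρ (q 1) (q 2) * (W ρ (q 0) (q 1) * W ρ (q 2) (q 3)))) = 0 := by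
    rw [← hlaw]; ring
  rcases mul_eq_zero.mp h4 with h | h
  · exact ht (pow_eq_zero_iff (by norm_num) |>.mp h)
  · exact hq h

end Summit.ValiantsHypothesis.ValiantsHypothesis.Theorems.LacunarySymmetroidMatrixDescartes.Census
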